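import Summits.QuantumFields.YangMills.Theorems.ComplexCouplingChannelComplexStrongCouplingAnchor
import Summits.QuantumFields.YangMills.Theorems.ComplexCouplingChannelFreeEnergyWindowChannelStubEnvelopeCriterion
import Summits.QuantumFields.YangMills.Theorems.ComplexCouplingChannelFreeEnergyWindowChannelStubGrowth
import Summits.QuantumFields.YangMills.Theorems.ComplexCouplingChannelFreeEnergyWindowChannelStubLogEnvelope
import Summits.QuantumFields.YangMills.Theorems.ComplexCouplingChannelFreeEnergyWindowChannelStubLocalRePart
import Summits.QuantumFields.YangMills.Theorems.ComplexCouplingChannelFreeEnergyWindowChannelStubReChain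
import Summits.QuantumFields.YangMills.Theorems.ComplexCouplingChannelFreeEnergyWindowChannelStubLocalWindowOfCauchy
import Summits.QuantumFields.YangMills.Theorems.ComplexCouplingChannelFreeEnergyWindowChannelStubPatchLocalWindows
import Summits.QuantumFields.YangMills.Theorems.ComplexCouplingChannelFreeEnergyWindowChannelTransportCriterion
import Literature.MathematicalPhysics.QuantumFieldTheory.WilsonFinTorusPartitionComplex

/-!
# The pointwise transport: zero-free channels at a fixed `(G, r, β)` carry free-energy windows

Stub `stub_transportAt` (layer 4 of line `Sketch`, idea `log-envelope-transport`) of the crux `FreeEnergyWindowChannel`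
(stmt-QuantumFields-18842, route `ComplexCouplingChannel` of `QuantumFields/YangMills`).

The landed transport `envelope_of_torusZeroFree` (file `…FreeEnergyWindowChannelTransportCriterion.lean`) turns the bare
symmetric-torus zero-freeness statement T into the envelope statement E at the level of the crux's full binder prefix
`∀ G ∀ r ∃ β₁ ∀ β ≥ β₁`.  Its proof is local in `(G, r, β)`; THIS FILE records the POINTWISE form, so that any repair of
the binder prefix (e.g. `[SimplyConnectedSpace G]`) inherits "zero-free channel at `β` ⇒ window channel at `β`"
verbatim:

* `window_of_torusZeroFreeAt`: at a fixed admissible `(G, r)` and real `β`, if for every `ρ > 0` an open connected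
  channel `D ∋ β` reaches a real point `x`, `|x| < ρ`, with `Z_P(z) = wilsonFinTorusPartitionC r.ρ z P P P P ≠ 0` on `D`
  for `P ≥ P₀`, then some open connected `U ∋ 0, β` carries ONE holomorphic `f`, `f 0 = 0`, and constants `M, P₁` with
  the zero-free two-sided window `Z_P z ≠ 0 ∧ |log ‖Z_P z‖ + P⁴ Re f z| ≤ M` (`P ≥ P₁`, `z ∈ U`);
* `stub_transportAt` (the registered signature): the same hypothesis gives the crux's body at `(G, r, β)` for every
  `ρ > 0` (the real point is `x := 0 ∈ U`).

Mechanism (the body of `envelope_of_torusZeroFree` with `(G, r, β)` held fixed; every step is a landed, already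
pointwise helper of the line): take the zero-free channel at radius `ρ₀ / 2` (`ρ₀` the disc of the proved anchor
`complexStrongCouplingAnchor_proof`) and join it to `ball 0 ρ₀`; `stub_growth` (`‖Z_P‖ ≤ e^{a P⁴ ‖z‖}`),
`stub_connectedCompactJoin` (compactly contained connected sub-channels), `stub_logEnvelope` (a-priori envelope
`|log ‖Z_P‖| ≤ A P⁴`), `stub_localRePart` + `stub_reChain` (real-part two-constants chain for
`u = P⁻⁴ log ‖Z_P‖ − Q⁻⁴ log ‖Z_Q‖`, small on the anchor disc by the anchor's exponential pinning: uniformly Cauchy with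
rate `e^{-cθP}`), `stub_localWindowOfCauchy` (local windows with constant `5 P⁴ b_P ≤ Mb`, using
`pow_four_mul_exp_neg_le`), `stub_patchLocalWindows` (one `f` on an open connected `U ∋ 0, β`), and the normalisation
`f ↦ f − f 0` (`Z_P 0 = 1`).

References: R. Nevanlinna, *Eindeutige analytische Funktionen* (1936) §III.2 (two-constants theorem); the transport file
`Summits/QuantumFields/YangMills/Theorems/ComplexCouplingChannelFreeEnergyWindowChannelTransportCriterion.lean`; the line
file `Summits/QuantumFields/YangMills/Cruxes/FreeEnergyWindowChannel/Lines/Sketch.lean`.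
-/

open MeasureTheory Complex Metric Set Filter Topology

namespace Summit.QuantumFields.YangMills.Theorems.FreeEnergyWindowChannel

/-- **Pointwise transport, normalised form.**  At a fixed admissible `(G, r)` and real `β`: zero-free symmetric-torus
channels at `β` reaching arbitrarily small real points give an open connected `U ∋ 0, β`, one holomorphic `f` on `U` with
`f 0 = 0`, and `M, P₁` with `Z_P z ≠ 0 ∧ |log ‖Z_P z‖ + P⁴ Re f z| ≤ M` for `P ≥ P₁`, `z ∈ U`.  Proof: the body of
`envelope_of_torusZeroFree` with `(G, r, β)` held fixed (see the module docstring). -/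
theorem window_of_torusZeroFreeAt (G : Type) [Group G] [TopologicalSpace G] [IsTopologicalGroup G] [CompactSpace G]
    [MeasurableSpace G] [BorelSpace G]
    (hG : Literature.MathematicalPhysics.QuantumFieldTheory.IsCompactSimpleLieGroup G)
    (r : Literature.MathematicalPhysics.QuantumFieldTheory.LatticeRep G) (β : ℝ)
    (hT : ∀ ρ : ℝ, 0 < ρ →
      ∃ D : Set ℂ, IsOpen D ∧ IsConnected D ∧ (β : ℂ) ∈ D ∧ (∃ x : ℝ, |x| < ρ ∧ (x : ℂ) ∈ D) ∧
        ∃ P₀ : ℕ, ∀ P : ℕ, P₀ ≤ P → ∀ z ∈ D,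
          Literature.MathematicalPhysics.QuantumFieldTheory.wilsonFinTorusPartitionC r.ρ z P P P P ≠ 0) :
    ∃ U : Set ℂ, IsOpen U ∧ IsConnected U ∧ (0 : ℂ) ∈ U ∧ (β : ℂ) ∈ U ∧
      ∃ f : ℂ → ℂ, DifferentiableOn ℂ f U ∧ f 0 = 0 ∧ ∃ M : ℝ, ∃ P₁ : ℕ, ∀ P : ℕ, P₁ ≤ P → ∀ z ∈ U,
        Literature.MathematicalPhysics.QuantumFieldTheory.wilsonFinTorusPartitionC r.ρ z P P P P ≠ 0 ∧
          |Real.log ‖Literature.MathematicalPhysics.QuantumFieldTheory.wilsonFinTorusPartitionC r.ρ z P P P P‖ +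
            (P : ℝ) ^ 4 * (f z).re| ≤ M := by
  haveI : SecondCountableTopology G :=
    (r.continuous.isClosedEmbedding r.injective).isEmbedding.secondCountableTopology
  -- adapted from `envelope_of_torusZeroFree` (…FreeEnergyWindowChannelTransportCriterion.lean), binders held fixed
  set Z : ℕ → ℂ → ℂ := fun P z =>
    Literature.MathematicalPhysics.QuantumFieldTheory.wilsonFinTorusPartitionC r.ρ z P P P P with hZ
  have hZd : ∀ P : ℕ, Differentiable ℂ (Z P) := fun P =>
    Literature.MathematicalPhysics.QuantumFieldTheory.differentiable_wilsonFinTorusPartitionC r.ρ r.continuous P P P P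
  have hZ1 : ∀ P : ℕ, Z P 0 = 1 := fun P =>
    Literature.MathematicalPhysics.QuantumFieldTheory.wilsonFinTorusPartitionC_zero r.ρ P P P P
  -- the proved anchor (torus clause)
  obtain ⟨ρ₀, hρ₀, c, hc, -, fA, hfA, C, hA⟩ :=
    Summit.QuantumFields.YangMills.Theorems.complexStrongCouplingAnchor_proof G hG r
  have hA' : ∀ P : ℕ, 1 ≤ P → ∀ z : ℂ, ‖z‖ < ρ₀ → Z P z ≠ 0 ∧
      |Real.log ‖Z P z‖ + (P : ℝ) ^ 4 * (fA z).re| ≤ C * (P : ℝ) ^ 4 * Real.exp (-(c * P)) :=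
    fun P hP z hz => hA P hP z hz
  -- growth
  obtain ⟨a, ha0, hgrowth⟩ := stub_growth G r
  have hgrowth' : ∀ (P : ℕ) (z : ℂ), ‖Z P z‖ ≤ Real.exp (a * (P : ℝ) ^ 4 * ‖z‖) := fun P z => hgrowth z P
  -- the zero-free channel at radius `ρ₀ / 2`, through the anchor disc
  obtain ⟨DT, hDTo, hDTc, hβDT, ⟨x, hxρ, hxDT⟩, P₀, hfree⟩ := hT (ρ₀ / 2) (half_pos hρ₀)
  set D : Set ℂ := DT ∪ ball (0 : ℂ) ρ₀ with hD
  have hDo : IsOpen D := hDTo.union isOpen_ball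
  have hxball : (x : ℂ) ∈ ball (0 : ℂ) ρ₀ := by
    rw [mem_ball_zero_iff, norm_real, Real.norm_eq_abs]; linarith
  have hDc : IsConnected D :=
    hDTc.union ⟨(x : ℂ), hxDT, hxball⟩ ((convex_ball _ _).isConnected ⟨0, mem_ball_self hρ₀⟩)
  have h0D : (0 : ℂ) ∈ D := Or.inr (mem_ball_self hρ₀)
  have hβD : (β : ℂ) ∈ D := Or.inl hβDT
  set P₀' : ℕ := max P₀ 1 with hP₀'
  have hP₀'1 : 1 ≤ P₀' := le_max_right _ _
  have hfreeD : ∀ P : ℕ, P₀' ≤ P → ∀ z ∈ D, Z P z ≠ 0 := by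
    intro P hP z hz
    rcases hz with hz | hz
    · exact hfree P ((le_max_left _ _).trans hP) z hz
    · exact (hA' P ((le_max_right _ _).trans hP) z (mem_ball_zero_iff.1 hz)).1
  -- Step A: a connected compactly contained sub-channel
  obtain ⟨D₁, K₁, hD₁o, hD₁c, hK₁, h0D₁, hβD₁, hD₁K₁, hK₁D⟩ :=
    Summit.QuantumFields.YangMills.Theorems.FreeEnergyWindowChannel.stub_connectedCompactJoin D hDo hDc 0 h0D β hβD
  -- Step B: a-priori envelope on `K₁ ⊇ D₁`
  obtain ⟨A, hA0, hApr⟩ := stub_logEnvelope Z a D P₀' ha0 hDo hDc.isPreconnected h0D hP₀'1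
    (fun P => (hZd P).differentiableOn) hZ1 hgrowth' hfreeD K₁ hK₁ hK₁D
  -- Step A': a second one inside `D₁`
  obtain ⟨D₂, K₂, hD₂o, hD₂c, hK₂, h0D₂, hβD₂, hD₂K₂, hK₂D₁⟩ :=
    Summit.QuantumFields.YangMills.Theorems.FreeEnergyWindowChannel.stub_connectedCompactJoin D₁ hD₁o hD₁c 0 h0D₁ β
      hβD₁
  -- Step C: the real-part chain on `(D₁, 0, ρ₀, K₂)`
  obtain ⟨θ, hθ0, hθ1, C₀, hC₀, hchain⟩ :=
    stub_reChain D₁ hD₁o hD₁c.isPreconnected 0 h0D₁ ρ₀ hρ₀ K₂ hK₂ hK₂D₁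
  set C' : ℝ := max C 1 with hC'
  have hC'0 : 0 < C' := lt_of_lt_of_le one_pos (le_max_right _ _)
  set B : ℝ := max (2 * A) (2 * C') with hB
  have hB0 : 0 < B := lt_of_lt_of_le (by positivity) (le_max_right _ _)
  set b : ℕ → ℝ := fun P => C₀ * (2 * C' * Real.exp (-(c * P))) ^ θ * B ^ (1 - θ) with hb
  have hb0 : ∀ P : ℕ, 0 < b P := fun P => by rw [hb]; positivity
  -- the Cauchy estimate on `K₂`
  have hcauchy : ∀ P Q : ℕ, P₀' ≤ P → P ≤ Q → ∀ z ∈ K₂,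
      |((P : ℝ) ^ 4)⁻¹ * Real.log ‖Z P z‖ - ((Q : ℝ) ^ 4)⁻¹ * Real.log ‖Z Q z‖| ≤ b P := by
    intro P Q hP hPQ z hz
    have hQ : P₀' ≤ Q := hP.trans hPQ
    have hP1 : 1 ≤ P := hP₀'1.trans hP
    have hQ1 : 1 ≤ Q := hP₀'1.trans hQ
    have hP4 : (0 : ℝ) < (P : ℝ) ^ 4 := by positivity
    have hQ4 : (0 : ℝ) < (Q : ℝ) ^ 4 := by positivity
    set u : ℂ → ℝ := fun w => ((P : ℝ) ^ 4)⁻¹ * Real.log ‖Z P w‖ - ((Q : ℝ) ^ 4)⁻¹ * Real.log ‖Z Q w‖ with hu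
    -- locally a real part on `D₁`
    have hure : ∀ (c₁ : ℂ) (R : ℝ), 0 < R → ball c₁ R ⊆ D₁ →
        ∃ φ : ℂ → ℂ, DifferentiableOn ℂ φ (ball c₁ R) ∧ ∀ w ∈ ball c₁ R, (φ w).re = u w :=
      fun c₁ R hR hsub => stub_localRePart (Z P) (Z Q) _ _ D₁ hD₁o (hZd P).differentiableOn
        (hZd Q).differentiableOn (fun w hw => hfreeD P hP w (hK₁D (hD₁K₁ hw)))
        (fun w hw => hfreeD Q hQ w (hK₁D (hD₁K₁ hw))) c₁ R hR hsub
    -- the two constants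
    set ε : ℝ := C' * (Real.exp (-(c * P)) + Real.exp (-(c * Q))) with hε
    have hε0 : 0 < ε := by rw [hε]; positivity
    have heP : Real.exp (-(c * P)) ≤ 1 := by
      rw [Real.exp_le_one_iff]; nlinarith [hc, (Nat.cast_nonneg P : (0 : ℝ) ≤ P)]
    have heQ : Real.exp (-(c * Q)) ≤ Real.exp (-(c * P)) := by
      rw [Real.exp_le_exp]; have : (P : ℝ) ≤ Q := by exact_mod_cast hPQ
      nlinarith
    have hεle : ε ≤ 2 * C' * Real.exp (-(c * P)) := by rw [hε]; nlinarith [hC'0]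
    have hεB : ε ≤ B := by
      refine le_trans ?_ (le_max_right _ _)
      nlinarith [hεle, Real.exp_pos (-(c * P))]
    have hbig : ∀ w ∈ D₁, |u w| ≤ B := by
      intro w hw
      have h1 := hApr P hP w (hD₁K₁ hw)
      have h2 := hApr Q hQ w (hD₁K₁ hw)
      have e1 : |((P : ℝ) ^ 4)⁻¹ * Real.log ‖Z P w‖| ≤ A := by
        rw [abs_mul, abs_inv, abs_of_pos hP4, inv_mul_le_iff₀ hP4]; linarith
      have e2 : |((Q : ℝ) ^ 4)⁻¹ * Real.log ‖Z Q w‖| ≤ A := by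
        rw [abs_mul, abs_inv, abs_of_pos hQ4, inv_mul_le_iff₀ hQ4]; linarith
      calc |u w| ≤ |((P : ℝ) ^ 4)⁻¹ * Real.log ‖Z P w‖| + |((Q : ℝ) ^ 4)⁻¹ * Real.log ‖Z Q w‖| :=
            abs_sub _ _
        _ ≤ 2 * A := by linarith
        _ ≤ B := le_max_left _ _
    have hsmall : ∀ w ∈ D₁, dist w 0 < ρ₀ → |u w| ≤ ε := by
      intro w _ hw
      rw [dist_zero_right] at hw
      have h1 := (hA' P hP1 w hw).2
      have h2 := (hA' Q hQ1 w hw).2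
      have e1 : |((P : ℝ) ^ 4)⁻¹ * Real.log ‖Z P w‖ + (fA w).re| ≤ C' * Real.exp (-(c * P)) := by
        rw [← inv_mul_add_mul_eq hP4.ne', abs_mul, abs_inv, abs_of_pos hP4, inv_mul_le_iff₀ hP4]
        calc |Real.log ‖Z P w‖ + (P : ℝ) ^ 4 * (fA w).re| ≤ C * (P : ℝ) ^ 4 * Real.exp (-(c * P)) := h1
          _ ≤ C' * (P : ℝ) ^ 4 * Real.exp (-(c * P)) := by gcongr; exact le_max_left _ _
          _ = (P : ℝ) ^ 4 * (C' * Real.exp (-(c * P))) := by ring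
      have e2 : |((Q : ℝ) ^ 4)⁻¹ * Real.log ‖Z Q w‖ + (fA w).re| ≤ C' * Real.exp (-(c * Q)) := by
        rw [← inv_mul_add_mul_eq hQ4.ne', abs_mul, abs_inv, abs_of_pos hQ4, inv_mul_le_iff₀ hQ4]
        calc |Real.log ‖Z Q w‖ + (Q : ℝ) ^ 4 * (fA w).re| ≤ C * (Q : ℝ) ^ 4 * Real.exp (-(c * Q)) := h2
          _ ≤ C' * (Q : ℝ) ^ 4 * Real.exp (-(c * Q)) := by gcongr; exact le_max_left _ _
          _ = (Q : ℝ) ^ 4 * (C' * Real.exp (-(c * Q))) := by ring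
      have hsplit : u w = (((P : ℝ) ^ 4)⁻¹ * Real.log ‖Z P w‖ + (fA w).re) -
          (((Q : ℝ) ^ 4)⁻¹ * Real.log ‖Z Q w‖ + (fA w).re) := by rw [hu]; ring
      rw [hsplit]
      calc |(((P : ℝ) ^ 4)⁻¹ * Real.log ‖Z P w‖ + (fA w).re) - (((Q : ℝ) ^ 4)⁻¹ * Real.log ‖Z Q w‖ + (fA w).re)|
          ≤ |((P : ℝ) ^ 4)⁻¹ * Real.log ‖Z P w‖ + (fA w).re| + |((Q : ℝ) ^ 4)⁻¹ * Real.log ‖Z Q w‖ + (fA w).re| :=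
            abs_sub _ _
        _ ≤ C' * Real.exp (-(c * P)) + C' * Real.exp (-(c * Q)) := add_le_add e1 e2
        _ = ε := by rw [hε]; ring
    have key := hchain u B ε hure hε0 hεB hbig hsmall z hz
    calc |u z| ≤ C₀ * ε ^ θ * B ^ (1 - θ) := key
      _ ≤ C₀ * (2 * C' * Real.exp (-(c * P))) ^ θ * B ^ (1 - θ) := by
          gcongr
      _ = b P := by rw [hb]
  -- `b → 0`
  have hbt : Tendsto b atTop (𝓝 0) := by
    have h1 : Tendsto (fun P : ℕ => Real.exp (-(c * P))) atTop (𝓝 0) := by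
      have := Real.tendsto_exp_neg_atTop_nhds_zero.comp
        ((tendsto_natCast_atTop_atTop (R := ℝ)).const_mul_atTop hc)
      simpa [Function.comp_def] using this
    have h2 : Tendsto (fun P : ℕ => (2 * C' * Real.exp (-(c * P))) ^ θ) atTop (𝓝 0) := by
      have h3 : Tendsto (fun P : ℕ => 2 * C' * Real.exp (-(c * P))) atTop (𝓝 0) := by
        simpa using h1.const_mul (2 * C')
      have h4 := h3.rpow_const (p := θ) (Or.inr hθ0.le)
      simpa [Real.zero_rpow hθ0.ne'] using h4
    have h5 := (h2.const_mul C₀).mul_const (B ^ (1 - θ))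
    simpa [hb] using h5
  -- the uniform constant of the local windows
  set Mb : ℝ := 5 * (C₀ * (2 * C') ^ θ * B ^ (1 - θ) * (24 / (c * θ) ^ 4)) with hMb
  have hbP : ∀ P : ℕ, 5 * (P : ℝ) ^ 4 * b P ≤ Mb := by
    intro P
    have h1 := Summit.QuantumFields.YangMills.Theorems.ComplexCouplingChannel.pow_four_mul_exp_neg_le
      (mul_pos hc hθ0) (Nat.cast_nonneg P)
    have h2 : (2 * C' * Real.exp (-(c * P))) ^ θ = (2 * C') ^ θ * Real.exp (-(c * θ * P)) := by
      rw [Real.mul_rpow (by positivity) (Real.exp_pos _).le, ← Real.exp_mul]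
      congr 2; ring
    have h3 : 5 * (P : ℝ) ^ 4 * b P =
        5 * (C₀ * (2 * C') ^ θ * B ^ (1 - θ) * ((P : ℝ) ^ 4 * Real.exp (-(c * θ * P)))) := by
      rw [hb]; simp only; rw [h2]; ring
    rw [h3, hMb]
    gcongr
  -- Step E: local windows at every point of `D₂`
  have hloc : ∀ y ∈ D₂, ∃ s : ℝ, 0 < s ∧ ball y s ⊆ D₂ ∧ ∃ g : ℂ → ℂ, DifferentiableOn ℂ g (ball y s) ∧
      ∃ M : ℝ, ∃ P₁ : ℕ, ∀ P : ℕ, P₁ ≤ P → ∀ z ∈ ball y s,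
        Z P z ≠ 0 ∧ |Real.log ‖Z P z‖ + (P : ℝ) ^ 4 * (g z).re| ≤ M := by
    intro y hy
    obtain ⟨s₂, hs₂, hs₂D⟩ := Metric.isOpen_iff.1 hD₂o y hy
    set s : ℝ := s₂ / 2 with hs
    have h2s : 2 * s = s₂ := by rw [hs]; ring
    have hballD₂ : ball y (2 * s) ⊆ D₂ := by rw [h2s]; exact hs₂D
    have hcy : ∀ P Q : ℕ, P₀' ≤ P → P ≤ Q → ∀ z ∈ ball y (2 * s),
        |((P : ℝ) ^ 4)⁻¹ * Real.log ‖Z P z‖ - ((Q : ℝ) ^ 4)⁻¹ * Real.log ‖Z Q z‖| ≤ b P :=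
      fun P Q hP hPQ z hz => hcauchy P Q hP hPQ z (hD₂K₂ (hballD₂ hz))
    obtain ⟨g, hg, hwin⟩ := stub_localWindowOfCauchy Z y s P₀' b (by rw [hs]; positivity) hP₀'1
      (fun P _ => (hZd P).differentiableOn)
      (fun P hP z hz => hfreeD P hP z (hK₁D (hD₁K₁ (hK₂D₁ (hD₂K₂ (hballD₂ hz)))))) hb0 hbt hcy
    refine ⟨s, by rw [hs]; positivity, (ball_subset_ball (by rw [hs]; linarith)).trans hballD₂, g, hg, Mb, P₀',
      fun P hP z hz => ⟨?_, (hwin P hP z hz).trans (hbP P)⟩⟩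
    exact hfreeD P hP z (hK₁D (hD₁K₁ (hK₂D₁ (hD₂K₂ (hballD₂ (ball_subset_ball (by rw [hs]; linarith) hz))))))
  -- Step F: patch the local windows along a chain from `0` to `β`
  obtain ⟨U, hUo, hUc, h0U, hβU, -, f, hf, M, P₁, hwinU⟩ :=
    stub_patchLocalWindows Z D₂ hD₂o hD₂c 0 h0D₂ β hβD₂ hloc
  -- normalise at `0` (`Z_P 0 = 1`) and read off the window
  refine ⟨U, hUo, hUc, h0U, hβU, fun z => f z - f 0, hf.sub (differentiableOn_const _), sub_self _,
    M + M, P₁, fun P hP z hz => ?_⟩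
  obtain ⟨hz0, hzb⟩ := hwinU P hP z hz
  obtain ⟨-, h0b⟩ := hwinU P hP 0 h0U
  rw [hZ1 P, norm_one, Real.log_one, zero_add] at h0b
  refine ⟨hz0, ?_⟩
  have key : |Real.log ‖Z P z‖ + (P : ℝ) ^ 4 * (f z - f 0).re| ≤ M + M := by
    rw [Complex.sub_re, mul_sub, ← add_sub_assoc]
    exact (abs_sub _ _).trans (add_le_add hzb h0b)
  exact key

/-- **Registered stub `stub_transportAt` of line `Sketch`** (layer 4: POINTWISE TRANSPORT).  At a fixed admissible `(G, r)`
and a fixed real `β`: if for every `ρ > 0` an open connected zero-free channel `D ∋ β` (symmetric tori `Z_P`, `P ≥ P₀`)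
reaches a real point `x`, `|x| < ρ`, then for every `ρ > 0` such a channel carries a window — one holomorphic `f` and one
constant `M` with `Z_P z ≠ 0 ∧ |log ‖Z_P z‖ + P⁴ Re f z| ≤ M`.  Proof: `window_of_torusZeroFreeAt` gives the window on an
open connected `U ∋ 0, β`; the real point is `x := 0`. -/
theorem stub_transportAt :
    ∀ (G : Type) [Group G] [TopologicalSpace G] [IsTopologicalGroup G] [CompactSpace G] [MeasurableSpace G] [BorelSpace G], Literature.MathematicalPhysics.QuantumFieldTheory.IsCompactSimpleLieGroup G → ∀ r : Literature.MathematicalPhysics.QuantumFieldTheory.LatticeRep G, ∀ β : ℝ,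
      (∀ ρ : ℝ, 0 < ρ →
        ∃ D : Set ℂ, IsOpen D ∧ IsConnected D ∧ (β : ℂ) ∈ D ∧ (∃ x : ℝ, |x| < ρ ∧ (x : ℂ) ∈ D) ∧
          ∃ P₀ : ℕ, ∀ P : ℕ, P₀ ≤ P → ∀ z ∈ D,
            Literature.MathematicalPhysics.QuantumFieldTheory.wilsonFinTorusPartitionC r.ρ z P P P P ≠ 0) →
      ∀ ρ : ℝ, 0 < ρ →
        ∃ D : Set ℂ, IsOpen D ∧ IsConnected D ∧ (β : ℂ) ∈ D ∧ (∃ x : ℝ, |x| < ρ ∧ (x : ℂ) ∈ D) ∧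
          ∃ f : ℂ → ℂ, DifferentiableOn ℂ f D ∧ ∃ M : ℝ, ∃ P₀ : ℕ, ∀ P : ℕ, P₀ ≤ P → ∀ z ∈ D,
            Literature.MathematicalPhysics.QuantumFieldTheory.wilsonFinTorusPartitionC r.ρ z P P P P ≠ 0 ∧
              |Real.log ‖Literature.MathematicalPhysics.QuantumFieldTheory.wilsonFinTorusPartitionC r.ρ z P P P P‖ +
                (P : ℝ) ^ 4 * (f z).re| ≤ M := by
  intro G _ _ _ _ _ _ hG r β hT ρ hρ
  obtain ⟨U, hUo, hUc, h0U, hβU, f, hf, -, M, P₁, hwin⟩ := window_of_torusZeroFreeAt G hG r β hT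
  exact ⟨U, hUo, hUc, hβU, ⟨0, by simpa using hρ, by simpa using h0U⟩, f, hf, M, P₁, hwin⟩

end Summit.QuantumFields.YangMills.Theorems.FreeEnergyWindowChannel
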